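import Mathlib
import HarnessLib
import Summits.ValiantsHypothesis.ValiantsHypothesis.Theorems.LacunarySymmetroidMatrixDescartesOsculationLawRankOneCurve

/-!
# `MatrixDescartes` (stmt-ValiantsHypothesis-18050, V1), line «osculation-law» — θ-calculus and pseudo-reduction
# of the bordered log-Hessian for a NON-MONIC quadratic letter `Ψ = a(t)·b² + m(t)·b + δ(t)`

Helpers toward the `(r,s) = (2,1)` block splitting of `OsculationLawAt 3 K ·` (val-idea-2 g2 line file
`Cruxes/MatrixDescartes/Lines/osculation_law.lean`): inserting a rank-two letter `b·(I₂ ⊕ 0)` into a symmetric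
`3 × 3` pencil `G = [[G₁₁, g], [gᵀ, h]]` gives the insertion polynomial `Φ(t,b) = det(G + b(I₂ ⊕ 0)) =
h·b² + m·b + det G` with `h = det G₂₂ = lowerDet` (a SIGNED `K`-nomial — the letter is NOT monic in `b`, unlike the
`(2,0)` splitting of `…OsculationLawTwoKCusp`) and `m = G₁₁⁽¹¹⁾h − g₁² + G₁₁⁽²²⁾h − g₂²`.  This file does the
algebra for the abstract shape `Ψ = X₁X₁·ι a + X₁·ι m + ι δ` (`ι = Polynomial.aeval (X 0)`, the embedding used by the
line's helper files; the same `Ψ` as `…FoldLawTwoKCurve`).  To keep every statement small, values are passed as real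
variables `A, M, D` (of `a, m, δ` at `t`), `A₁ = (θa)(t) = t·a′(t)`, `A₂ = (θ²a)(t) = t·a′(t) + t²·a″(t)`, … tied to
the polynomials by hypotheses `hA : a.eval t = A`, …, and the remainder polynomials `U`, `V` are passed as `Up`, `Vp`
with defining hypotheses (instantiate all of them with `rfl`).

* `eval_logHessian_Psi` — the line's bordered log-Hessian `H(Ψ)` (`θ₀ = t∂ₜ`, `θ₁ = b∂_b`) at a point, as an
  explicit integer polynomial `H` in `b` and the nine values;
* `hess_pseudo_reduce` — the PSEUDO-DIVISION identity `A⁴ · H = Q · (A b² + M b + D) + (U · b + V)` (one `ring`;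
  `Q`, `U`, `V` explicit integer polynomials with 35 / 20 / 15 terms, found by exact rational arithmetic and checked
  here by the kernel; at `a ≡ 1` the pair `(U, V)` specialises to the monic `(A, B)` of `OsculationCusp.hess_reduce`);
* `eval_U`, `eval_V` — `U`, `V` as values of honest polynomials in `t` built from `a, m, δ` with `θ = X·d/dX`
  (isobaric of weights 12 and 13 for `wt(a, m, δ) = (1, 2, 3)` — the source of support bounds downstream);
* `hess_reduce_poly` — on the curve `Ψ(t,b) = 0`: `A⁴ · H = U(t)·b + V(t)`;
* `resultant_step`, `osc_abscissa`, `osc_abscissa_root`, `osc_ordinate_eq` — at an osculation point (`Ψ = 0`,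
  `H = 0`): `U(t) b + V(t) = 0`, hence `A·V(t)² − M·U(t)V(t) + D·U(t)² = 0`; every osculation abscissa with
  `U(t) ≠ 0` is a root of the single polynomial `N = aV² − mUV + δU²` (weight 27) and carries one ordinate `−V/U`.

Honest framing.  Pure identities (helpers, `--supports`); they do NOT count the osculation set of the `(2,1)`
splitting (the sub-cases `U(t) = V(t) = 0`, `a(t) = 0`, `N ≡ 0` and the support count are not done here), and do
not touch `OsculationLaw`, `stub_peel`, `stub_recursion`, `MatrixDescartes`, Conjecture B or `VP ≠ VNP` (all OPEN /
NOT proved).  No definitions, no named facts; Mathlib + the tree file `…OsculationLawRankOneCurve`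
(`OsculationRankOne.eval_aevalX0`, `pderiv_zero_aevalX0`, `pderiv_one_aevalX0`).
-/

-- `Summit.ValiantsHypothesis.ValiantsHypothesis.…` is the tree's mandated single-conjunct layout (Sub = Summit).
set_option linter.dupNamespace false

namespace Summit.ValiantsHypothesis.ValiantsHypothesis.Theorems.LacunarySymmetroidMatrixDescartes

open Polynomial Set
open scoped BigOperators

namespace OsculationCuspGen

/-! ### θ-calculus for `Ψ = X₁X₁·ι a + X₁·ι m + ι δ` -/

/-- The bordered log-Hessian `H(Ψ)` of `Ψ = X₁X₁·ι a + X₁·ι m + ι δ` at `p = (t,b)` in values: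
`H = θ₀²Ψ·(θ₁Ψ)² − 2·θ₀θ₁Ψ·θ₀Ψ·θ₁Ψ + θ₁²Ψ·(θ₀Ψ)²` with `θ₁Ψ = 2Ab² + Mb`, `θ₁²Ψ = 4Ab² + Mb`,
`θ₀Ψ = A₁b² + M₁b + D₁`, `θ₀²Ψ = A₂b² + M₂b + D₂`, `θ₀θ₁Ψ = 2A₁b² + M₁b`. [folklore] -/
theorem eval_logHessian_Psi (a m δ : ℝ[X]) (Ψ : MvPolynomial (Fin 2) ℝ) (hΨ : Ψ = (MvPolynomial.X 1 * MvPolynomial.X 1 * Polynomial.aeval (MvPolynomial.X 0 : MvPolynomial (Fin 2) ℝ) a + MvPolynomial.X 1 * Polynomial.aeval (MvPolynomial.X 0 : MvPolynomial (Fin 2) ℝ) m + Polynomial.aeval (MvPolynomial.X 0 : MvPolynomial (Fin 2) ℝ) δ))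
    (p : Fin 2 → ℝ) (A M A₁ M₁ D₁ A₂ M₂ D₂ : ℝ)
    (hA : a.eval (p 0) = A)
    (hA₁ : (p 0) * (derivative a).eval (p 0) = A₁)
    (hA₂ : (p 0) * (derivative a).eval (p 0) + (p 0) ^ 2 * (derivative (derivative a)).eval (p 0) = A₂)
    (hM : m.eval (p 0) = M)
    (hM₁ : (p 0) * (derivative m).eval (p 0) = M₁)
    (hM₂ : (p 0) * (derivative m).eval (p 0) + (p 0) ^ 2 * (derivative (derivative m)).eval (p 0) = M₂)
    (hD₁ : (p 0) * (derivative δ).eval (p 0) = D₁)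
    (hD₂ : (p 0) * (derivative δ).eval (p 0) + (p 0) ^ 2 * (derivative (derivative δ)).eval (p 0) = D₂) :
    MvPolynomial.eval p
        (MvPolynomial.X 0 * MvPolynomial.pderiv 0 (MvPolynomial.X 0 * MvPolynomial.pderiv 0 Ψ)
            * (MvPolynomial.X 1 * MvPolynomial.pderiv 1 Ψ) ^ 2
          - 2 * (MvPolynomial.X 0 * MvPolynomial.pderiv 0 (MvPolynomial.X 1 * MvPolynomial.pderiv 1 Ψ))
            * (MvPolynomial.X 0 * MvPolynomial.pderiv 0 Ψ) * (MvPolynomial.X 1 * MvPolynomial.pderiv 1 Ψ)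
          + MvPolynomial.X 1 * MvPolynomial.pderiv 1 (MvPolynomial.X 1 * MvPolynomial.pderiv 1 Ψ)
            * (MvPolynomial.X 0 * MvPolynomial.pderiv 0 Ψ) ^ 2) =
      (4 : ℝ) * p 1 ^ 6 * A ^ 2 * A₂ - (4 : ℝ) * p 1 ^ 6 * A * A₁ ^ 2 + (4 : ℝ) * p 1 ^ 5 * A ^ 2 * M₂ + (4 : ℝ) * p 1 ^ 5 * A * M * A₂ - (4 : ℝ) * p 1 ^ 5 * A * A₁ * M₁ - (3 : ℝ) * p 1 ^ 5 * M * A₁ ^ 2 + (4 : ℝ) * p 1 ^ 4 * A ^ 2 * D₂ + (4 : ℝ) * p 1 ^ 4 * A * M * M₂ + p 1 ^ 4 * M ^ 2 * A₂ - (4 : ℝ) * p 1 ^ 4 * M * A₁ * M₁ + (4 : ℝ) * p 1 ^ 3 * A * M * D₂ + (4 : ℝ) * p 1 ^ 3 * A * M₁ * D₁ + p 1 ^ 3 * M ^ 2 * M₂ - (2 : ℝ) * p 1 ^ 3 * M * A₁ * D₁ - p 1 ^ 3 * M * M₁ ^ 2 + (4 : ℝ) * p 1 ^ 2 * A * D₁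 ^ 2 + p 1 ^ 2 * M ^ 2 * D₂ + p 1 * M * D₁ ^ 2 := by
  subst hΨ hA hA₁ hA₂ hM hM₁ hM₂ hD₁ hD₂
  simp only [map_add, map_sub, map_mul, map_pow, MvPolynomial.pderiv_mul,
    MvPolynomial.pderiv_X_self, MvPolynomial.pderiv_X_of_ne (show (1 : Fin 2) ≠ 0 by decide),
    OsculationRankOne.pderiv_zero_aevalX0, OsculationRankOne.pderiv_one_aevalX0,
    MvPolynomial.eval_X, OsculationRankOne.eval_aevalX0, map_ofNat, map_one, mul_zero, zero_mul, add_zero,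
    zero_add, one_mul, mul_one]
  ring

/-! ### Pseudo-reduction modulo the non-monic quadratic -/

-- ≈ 90 monomials of degree ≤ 9 in 13 variables: statement elaboration + `ring` exceed the default budget (measured).
set_option maxHeartbeats 1600000 in
/-- **Pseudo-division of the Hessian by `Ψ = A b² + M b + D`**: `A⁴ · H = Q · Ψ + (U · b + V)`, an identity of
integer polynomials in `b` and the nine values (one `ring`; `Q`, `U`, `V` are passed by defining hypotheses —
instantiate with `rfl` — only to keep the statement's elaboration small). [folklore] -/
theorem hess_pseudo_reduce (b A M D A₁ M₁ D₁ A₂ M₂ D₂ Q U V : ℝ)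
    (hQ : Q = (4 : ℝ) * b ^ 4 * A ^ 5 * A₂ - (4 : ℝ) * b ^ 4 * A ^ 4 * A₁ ^ 2 + (4 : ℝ) * b ^ 3 * A ^ 5 * M₂ - (4 : ℝ) * b ^ 3 * A ^ 4 * A₁ * M₁ + b ^ 3 * A ^ 3 * M * A₁ ^ 2 + (4 : ℝ) * b ^ 2 * A ^ 5 * D₂ - (4 : ℝ) * b ^ 2 * A ^ 4 * D * A₂ + b ^ 2 * A ^ 3 * M ^ 2 * A₂ + (4 : ℝ) * b ^ 2 * A ^ 3 * D * A₁ ^ 2 - b ^ 2 * A ^ 2 * M ^ 2 * A₁ ^ 2 - (4 : ℝ) * b * A ^ 4 * D * M₂ + (4 : ℝ) * b * A ^ 4 * M₁ * D₁ + b * A ^ 3 * M ^ 2 * M₂ + (4 : ℝ) * b * A ^ 3 * M * D * A₂ - (2 : ℝ) * b * A ^ 3 * M * A₁ * D₁ - b * A ^ 3 * M * M₁ ^ 2 + (4 : ℝ) * b * A ^ 3 * D * A₁ * M₁ - b * A ^ 2 * M ^ 3 * A₂ - (5 : ℝ) * b * A ^ 2 * M * D * A₁ ^ 2 + b * A * M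 ^ 3 * A₁ ^ 2 - (4 : ℝ) * A ^ 4 * D * D₂ + (4 : ℝ) * A ^ 4 * D₁ ^ 2 + A ^ 3 * M ^ 2 * D₂ + (4 : ℝ) * A ^ 3 * M * D * M₂ - (4 : ℝ) * A ^ 3 * M * M₁ * D₁ + (4 : ℝ) * A ^ 3 * D ^ 2 * A₂ - A ^ 2 * M ^ 3 * M₂ - (5 : ℝ) * A ^ 2 * M ^ 2 * D * A₂ + (2 : ℝ) * A ^ 2 * M ^ 2 * A₁ * D₁ + A ^ 2 * M ^ 2 * M₁ ^ 2 - (4 : ℝ) * A ^ 2 * M * D * A₁ * M₁ - (4 : ℝ) * A ^ 2 * D ^ 2 * A₁ ^ 2 + A * M ^ 4 * A₂ + (6 : ℝ) * A * M ^ 2 * D * A₁ ^ 2 - M ^ 4 * A₁ ^ 2)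
    (hU : U = (4 : ℝ) * A ^ 4 * M * D * D₂ - (3 : ℝ) * A ^ 4 * M * D₁ ^ 2 + (4 : ℝ) * A ^ 4 * D ^ 2 * M₂ - (4 : ℝ) * A ^ 4 * D * M₁ * D₁ - A ^ 3 * M ^ 3 * D₂ - (5 : ℝ) * A ^ 3 * M ^ 2 * D * M₂ + (4 : ℝ) * A ^ 3 * M ^ 2 * M₁ * D₁ - (8 : ℝ) * A ^ 3 * M * D ^ 2 * A₂ + (2 : ℝ) * A ^ 3 * M * D * A₁ * D₁ + A ^ 3 * M * D * M₁ ^ 2 - (4 : ℝ) * A ^ 3 * D ^ 2 * A₁ * M₁ + A ^ 2 * M ^ 4 * M₂ + (6 : ℝ) * A ^ 2 * M ^ 3 * D * A₂ - (2 : ℝ) * A ^ 2 * M ^ 3 * A₁ * D₁ - A ^ 2 * M ^ 3 * M₁ ^ 2 + (4 : ℝ) * A ^ 2 * M ^ 2 * D * A₁ * M₁ + (9 : ℝ) * A ^ 2 * M * D ^ 2 * A₁ ^ 2 - A * M ^ 5 * A₂ - (7 : ℝ) * A * M ^ 3 * D * A₁ ^ 2 + M ^ 5 * A₁ ^ 2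)
    (hV : V = (4 : ℝ) * A ^ 4 * D ^ 2 * D₂ - (4 : ℝ) * A ^ 4 * D * D₁ ^ 2 - A ^ 3 * M ^ 2 * D * D₂ - (4 : ℝ) * A ^ 3 * M * D ^ 2 * M₂ + (4 : ℝ) * A ^ 3 * M * D * M₁ * D₁ - (4 : ℝ) * A ^ 3 * D ^ 3 * A₂ + A ^ 2 * M ^ 3 * D * M₂ + (5 : ℝ) * A ^ 2 * M ^ 2 * D ^ 2 * A₂ - (2 : ℝ) * A ^ 2 * M ^ 2 * D * A₁ * D₁ - A ^ 2 * M ^ 2 * D * M₁ ^ 2 + (4 : ℝ) * A ^ 2 * M * D ^ 2 * A₁ * M₁ + (4 : ℝ) * A ^ 2 * D ^ 3 * A₁ ^ 2 - A * M ^ 4 * D * A₂ - (6 : ℝ) * A * M ^ 2 * D ^ 2 * A₁ ^ 2 + M ^ 4 * D * A₁ ^ 2) :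
    A ^ 4 * ((4 : ℝ) * b ^ 6 * A ^ 2 * A₂ - (4 : ℝ) * b ^ 6 * A * A₁ ^ 2 + (4 : ℝ) * b ^ 5 * A ^ 2 * M₂ + (4 : ℝ) * b ^ 5 * A * M * A₂ - (4 : ℝ) * b ^ 5 * A * A₁ * M₁ - (3 : ℝ) * b ^ 5 * M * A₁ ^ 2 + (4 : ℝ) * b ^ 4 * A ^ 2 * D₂ + (4 : ℝ) * b ^ 4 * A * M * M₂ + b ^ 4 * M ^ 2 * A₂ - (4 : ℝ) * b ^ 4 * M * A₁ * M₁ + (4 : ℝ) * b ^ 3 * A * M * D₂ + (4 : ℝ) * b ^ 3 * A * M₁ * D₁ + b ^ 3 * M ^ 2 * M₂ - (2 : ℝ) * b ^ 3 * M * A₁ * D₁ - b ^ 3 * M * M₁ ^ 2 + (4 : ℝ) * b ^ 2 * A * D₁ ^ 2 + b ^ 2 * M ^ 2 * D₂ + b * M * D₁ ^ 2) = Q * (A * b ^ 2 + M * b + D) + (U * b + V) := by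
  subst hQ hU hV
  ring

/-- `U` — the `b`-coefficient of the pseudo-remainder — is the value at `t` of an honest polynomial built from
`a, m, δ` with `θ = X·d/dX` (20 terms, isobaric of weight 12 for `wt(a,m,δ) = (1,2,3)`). [folklore] -/
theorem eval_U (a m δ : ℝ[X]) (t : ℝ) (A M D A₁ M₁ D₁ A₂ M₂ D₂ : ℝ)
    (hA : a.eval t = A)
    (hA₁ : t * (derivative a).eval t = A₁)
    (hA₂ : t * (derivative a).eval t + t ^ 2 * (derivative (derivative a)).eval t = A₂)
    (hM : m.eval t = M)
    (hM₁ : t * (derivative m).eval t = M₁)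
    (hM₂ : t * (derivative m).eval t + t ^ 2 * (derivative (derivative m)).eval t = M₂)
    (hD : δ.eval t = D)
    (hD₁ : t * (derivative δ).eval t = D₁)
    (hD₂ : t * (derivative δ).eval t + t ^ 2 * (derivative (derivative δ)).eval t = D₂) :
    ((4 : ℝ[X]) * a ^ 4 * m * δ * (X * derivative (X * derivative δ)) - (3 : ℝ[X]) * a ^ 4 * m * (X * derivative δ) ^ 2 + (4 : ℝ[X]) * a ^ 4 * δ ^ 2 * (X * derivative (X * derivative m)) - (4 : ℝ[X]) * a ^ 4 * δ * (X * derivative m) * (X * derivative δ) - a ^ 3 * m ^ 3 * (X * derivative (X * derivative δ)) - (5 : ℝ[X]) * a ^ 3 * m ^ 2 * δ * (X * derivative (X * derivative m)) + (4 : ℝ[X]) * a ^ 3 * m ^ 2 * (X * derivative m) * (X * derivative δ) - (8 : ℝ[X]) * a ^ 3 * m * δ ^ 2 * (X * derivative (X * derivative a)) + (2 : ℝ[X]) * a ^ 3 * m * δ * (X * derivative a) * (X * derivative δ) + a ^ 3 * m * δ * (X * derivative m) ^ 2 - (4 : ℝ[X]) * a ^ 3 * δ ^ 2 * (X * derivative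 a) * (X * derivative m) + a ^ 2 * m ^ 4 * (X * derivative (X * derivative m)) + (6 : ℝ[X]) * a ^ 2 * m ^ 3 * δ * (X * derivative (X * derivative a)) - (2 : ℝ[X]) * a ^ 2 * m ^ 3 * (X * derivative a) * (X * derivative δ) - a ^ 2 * m ^ 3 * (X * derivative m) ^ 2 + (4 : ℝ[X]) * a ^ 2 * m ^ 2 * δ * (X * derivative a) * (X * derivative m) + (9 : ℝ[X]) * a ^ 2 * m * δ ^ 2 * (X * derivative a) ^ 2 - a * m ^ 5 * (X * derivative (X * derivative a)) - (7 : ℝ[X]) * a * m ^ 3 * δ * (X * derivative a) ^ 2 + m ^ 5 * (X * derivative a) ^ 2).eval t =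
      (4 : ℝ) * A ^ 4 * M * D * D₂ - (3 : ℝ) * A ^ 4 * M * D₁ ^ 2 + (4 : ℝ) * A ^ 4 * D ^ 2 * M₂ - (4 : ℝ) * A ^ 4 * D * M₁ * D₁ - A ^ 3 * M ^ 3 * D₂ - (5 : ℝ) * A ^ 3 * M ^ 2 * D * M₂ + (4 : ℝ) * A ^ 3 * M ^ 2 * M₁ * D₁ - (8 : ℝ) * A ^ 3 * M * D ^ 2 * A₂ + (2 : ℝ) * A ^ 3 * M * D * A₁ * D₁ + A ^ 3 * M * D * M₁ ^ 2 - (4 : ℝ) * A ^ 3 * D ^ 2 * A₁ * M₁ + A ^ 2 * M ^ 4 * M₂ + (6 : ℝ) * A ^ 2 * M ^ 3 * D * A₂ - (2 : ℝ) * A ^ 2 * M ^ 3 * A₁ * D₁ - A ^ 2 * M ^ 3 * M₁ ^ 2 + (4 : ℝ) * A ^ 2 * M ^ 2 * D * A₁ * M₁ + (9 : ℝ) * A ^ 2 * M * D ^ 2 * A₁ ^ 2 - A * M ^ 5 * A₂ - (7 : ℝ) * A * M ^ 3 * D * A₁ ^ 2 + M ^ 5 * A₁ ^ 2 := by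
  subst hA hA₁ hA₂ hM hM₁ hM₂ hD hD₁ hD₂
  simp only [eval_add, eval_sub, eval_mul, eval_pow, eval_X, eval_ofNat, derivative_mul, derivative_X, one_mul]
  ring

/-- `V` — the constant coefficient of the pseudo-remainder — likewise (15 terms, weight 13). [folklore] -/
theorem eval_V (a m δ : ℝ[X]) (t : ℝ) (A M D A₁ M₁ D₁ A₂ M₂ D₂ : ℝ)
    (hA : a.eval t = A)
    (hA₁ : t * (derivative a).eval t = A₁)
    (hA₂ : t * (derivative a).eval t + t ^ 2 * (derivative (derivative a)).eval t = A₂)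
    (hM : m.eval t = M)
    (hM₁ : t * (derivative m).eval t = M₁)
    (hM₂ : t * (derivative m).eval t + t ^ 2 * (derivative (derivative m)).eval t = M₂)
    (hD : δ.eval t = D)
    (hD₁ : t * (derivative δ).eval t = D₁)
    (hD₂ : t * (derivative δ).eval t + t ^ 2 * (derivative (derivative δ)).eval t = D₂) :
    ((4 : ℝ[X]) * a ^ 4 * δ ^ 2 * (X * derivative (X * derivative δ)) - (4 : ℝ[X]) * a ^ 4 * δ * (X * derivative δ) ^ 2 - a ^ 3 * m ^ 2 * δ * (X * derivative (X * derivative δ)) - (4 : ℝ[X]) * a ^ 3 * m * δ ^ 2 * (X * derivative (X * derivative m)) + (4 : ℝ[X]) * a ^ 3 * m * δ * (X * derivative m) * (X * derivative δ) - (4 : ℝ[X]) * a ^ 3 * δ ^ 3 * (X * derivative (X * derivative a)) + a ^ 2 * m ^ 3 * δ * (X * derivative (X * derivative m)) + (5 : ℝ[X]) * a ^ 2 * m ^ 2 * δ ^ 2 * (X * derivative (X * derivative a)) - (2 : ℝ[X]) * a ^ 2 * m ^ 2 * δ * (X * derivative a) * (X * derivative δ) - a ^ 2 * m ^ 2 *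 δ * (X * derivative m) ^ 2 + (4 : ℝ[X]) * a ^ 2 * m * δ ^ 2 * (X * derivative a) * (X * derivative m) + (4 : ℝ[X]) * a ^ 2 * δ ^ 3 * (X * derivative a) ^ 2 - a * m ^ 4 * δ * (X * derivative (X * derivative a)) - (6 : ℝ[X]) * a * m ^ 2 * δ ^ 2 * (X * derivative a) ^ 2 + m ^ 4 * δ * (X * derivative a) ^ 2).eval t =
      (4 : ℝ) * A ^ 4 * D ^ 2 * D₂ - (4 : ℝ) * A ^ 4 * D * D₁ ^ 2 - A ^ 3 * M ^ 2 * D * D₂ - (4 : ℝ) * A ^ 3 * M * D ^ 2 * M₂ + (4 : ℝ) * A ^ 3 * M * D * M₁ * D₁ - (4 : ℝ) * A ^ 3 * D ^ 3 * A₂ + A ^ 2 * M ^ 3 * D * M₂ + (5 : ℝ) * A ^ 2 * M ^ 2 * D ^ 2 * A₂ - (2 : ℝ) * A ^ 2 * M ^ 2 * D * A₁ * D₁ - A ^ 2 * M ^ 2 * D * M₁ ^ 2 + (4 : ℝ) * A ^ 2 * M * D ^ 2 * A₁ * M₁ + (4 : ℝ) * A ^ 2 * D ^ 3 * A₁ ^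 2 - A * M ^ 4 * D * A₂ - (6 : ℝ) * A * M ^ 2 * D ^ 2 * A₁ ^ 2 + M ^ 4 * D * A₁ ^ 2 := by
  subst hA hA₁ hA₂ hM hM₁ hM₂ hD hD₁ hD₂
  simp only [eval_add, eval_sub, eval_mul, eval_pow, eval_X, eval_ofNat, derivative_mul, derivative_X, one_mul]
  ring

-- the statement carries `U`, `V` (35 products of polynomials) and `H`: elaboration alone exceeds the default budget.
set_option maxHeartbeats 1600000 in
/-- **Reduction on the curve**: if `A b² + M b + D = 0` (the point lies on `Ψ = 0`) then
`A⁴ · H = U(t)·b + V(t)` with `U`, `V` the polynomials of `eval_U`, `eval_V`. [folklore] -/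
theorem hess_reduce_poly (a m δ Up Vp : ℝ[X]) (t b : ℝ) (A M D A₁ M₁ D₁ A₂ M₂ D₂ : ℝ)
    (hA : a.eval t = A)
    (hA₁ : t * (derivative a).eval t = A₁)
    (hA₂ : t * (derivative a).eval t + t ^ 2 * (derivative (derivative a)).eval t = A₂)
    (hM : m.eval t = M)
    (hM₁ : t * (derivative m).eval t = M₁)
    (hM₂ : t * (derivative m).eval t + t ^ 2 * (derivative (derivative m)).eval t = M₂)
    (hD : δ.eval t = D)
    (hD₁ : t * (derivative δ).eval t = D₁)
    (hD₂ : t * (derivative δ).eval t + t ^ 2 * (derivative (derivative δ)).eval t = D₂)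
    (hUp : Up = (4 : ℝ[X]) * a ^ 4 * m * δ * (X * derivative (X * derivative δ)) - (3 : ℝ[X]) * a ^ 4 * m * (X * derivative δ) ^ 2 + (4 : ℝ[X]) * a ^ 4 * δ ^ 2 * (X * derivative (X * derivative m)) - (4 : ℝ[X]) * a ^ 4 * δ * (X * derivative m) * (X * derivative δ) - a ^ 3 * m ^ 3 * (X * derivative (X * derivative δ)) - (5 : ℝ[X]) * a ^ 3 * m ^ 2 * δ * (X * derivative (X * derivative m)) + (4 : ℝ[X]) * a ^ 3 * m ^ 2 * (X * derivative m) * (X * derivative δ) - (8 : ℝ[X]) * a ^ 3 * m * δ ^ 2 * (X * derivative (X * derivative a)) + (2 : ℝ[X]) * a ^ 3 * m * δ * (X * derivative a) * (X * derivative δ) + a ^ 3 * m * δ * (X * derivative m) ^ 2 - (4 : ℝ[X]) * a ^ 3 * δ ^ 2 * (X * derivative a) * (X * derivative m) + a ^ 2 * m ^ 4 * (X * derivative (X * derivative m)) + (6 : ℝ[X]) * a ^ 2 * m ^ 3 * δ * (X * derivative (X * derivative a)) - (2 : ℝ[X]) * a ^ 2 * m ^ 3 * (X * derivative a) * (X *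 derivative δ) - a ^ 2 * m ^ 3 * (X * derivative m) ^ 2 + (4 : ℝ[X]) * a ^ 2 * m ^ 2 * δ * (X * derivative a) * (X * derivative m) + (9 : ℝ[X]) * a ^ 2 * m * δ ^ 2 * (X * derivative a) ^ 2 - a * m ^ 5 * (X * derivative (X * derivative a)) - (7 : ℝ[X]) * a * m ^ 3 * δ * (X * derivative a) ^ 2 + m ^ 5 * (X * derivative a) ^ 2)
    (hVp : Vp = (4 : ℝ[X]) * a ^ 4 * δ ^ 2 * (X * derivative (X * derivative δ)) - (4 : ℝ[X]) * a ^ 4 * δ * (X * derivative δ) ^ 2 - a ^ 3 * m ^ 2 * δ * (X * derivative (X * derivative δ)) - (4 : ℝ[X]) * a ^ 3 * m * δ ^ 2 * (X * derivative (X * derivative m)) + (4 : ℝ[X]) * a ^ 3 * m * δ * (X * derivative m) * (X * derivative δ) - (4 : ℝ[X]) * a ^ 3 * δ ^ 3 * (X * derivative (X * derivative a)) + a ^ 2 * m ^ 3 * δ * (X * derivative (X * derivative m)) + (5 : ℝ[X]) * a ^ 2 * m ^ 2 * δ ^ 2 * (X * derivative (X * derivative a)) - (2 : ℝ[X]) *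 a ^ 2 * m ^ 2 * δ * (X * derivative a) * (X * derivative δ) - a ^ 2 * m ^ 2 * δ * (X * derivative m) ^ 2 + (4 : ℝ[X]) * a ^ 2 * m * δ ^ 2 * (X * derivative a) * (X * derivative m) + (4 : ℝ[X]) * a ^ 2 * δ ^ 3 * (X * derivative a) ^ 2 - a * m ^ 4 * δ * (X * derivative (X * derivative a)) - (6 : ℝ[X]) * a * m ^ 2 * δ ^ 2 * (X * derivative a) ^ 2 + m ^ 4 * δ * (X * derivative a) ^ 2)
    (hΨ0 : A * b ^ 2 + M * b + D = 0) :
    A ^ 4 * ((4 : ℝ) * b ^ 6 * A ^ 2 * A₂ - (4 : ℝ) * b ^ 6 * A * A₁ ^ 2 + (4 : ℝ) * b ^ 5 * A ^ 2 * M₂ + (4 : ℝ) * b ^ 5 * A * M * A₂ - (4 : ℝ) * b ^ 5 * A * A₁ * M₁ - (3 : ℝ) * b ^ 5 * M * A₁ ^ 2 + (4 : ℝ) * b ^ 4 * A ^ 2 * D₂ + (4 : ℝ) * b ^ 4 * A * M * M₂ + b ^ 4 * M ^ 2 * A₂ - (4 : ℝ) * b ^ 4 * M * A₁ * M₁ +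 (4 : ℝ) * b ^ 3 * A * M * D₂ + (4 : ℝ) * b ^ 3 * A * M₁ * D₁ + b ^ 3 * M ^ 2 * M₂ - (2 : ℝ) * b ^ 3 * M * A₁ * D₁ - b ^ 3 * M * M₁ ^ 2 + (4 : ℝ) * b ^ 2 * A * D₁ ^ 2 + b ^ 2 * M ^ 2 * D₂ + b * M * D₁ ^ 2) = Up.eval t * b + Vp.eval t := by
  subst hUp hVp
  rw [eval_U a m δ t A M D A₁ M₁ D₁ A₂ M₂ D₂ hA hA₁ hA₂ hM hM₁ hM₂ hD hD₁ hD₂, eval_V a m δ t A M D A₁ M₁ D₁ A₂ M₂ D₂ hA hA₁ hA₂ hM hM₁ hM₂ hD hD₁ hD₂]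
  have hred := hess_pseudo_reduce b A M D A₁ M₁ D₁ A₂ M₂ D₂ _ _ _ rfl rfl rfl
  rw [hΨ0, mul_zero, zero_add] at hred
  exact hred

/-! ### The resultant step: one polynomial for the osculation abscissae -/

/-- Eliminating `b` between `A b² + M b + D = 0` and `u b + v = 0`: `A v² − M u v + D u² = 0`
(`= u²·Ψ(b) + (A(v − ub) − Mu)·(ub + v)`). [folklore] -/
theorem resultant_step (A M D u v b : ℝ) (hΨ : A * b ^ 2 + M * b + D = 0) (hl : u * b + v = 0) :
    A * v ^ 2 - M * u * v + D * u ^ 2 = 0 := by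
  linear_combination (u ^ 2) * hΨ + (A * (v - u * b) - M * u) * hl

-- same statement size as `hess_reduce_poly`.
set_option maxHeartbeats 1600000 in
/-- At an osculation point of the non-monic quadratic letter (`Ψ(t,b) = 0` and `H = 0`, the Hessian in values as
in `eval_logHessian_Psi`): `U(t)·b + V(t) = 0`. [folklore] -/
theorem osc_abscissa (a m δ Up Vp : ℝ[X]) (t b : ℝ) (A M D A₁ M₁ D₁ A₂ M₂ D₂ : ℝ)
    (hA : a.eval t = A)
    (hA₁ : t * (derivative a).eval t = A₁)
    (hA₂ : t * (derivative a).eval t + t ^ 2 * (derivative (derivative a)).eval t = A₂)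
    (hM : m.eval t = M)
    (hM₁ : t * (derivative m).eval t = M₁)
    (hM₂ : t * (derivative m).eval t + t ^ 2 * (derivative (derivative m)).eval t = M₂)
    (hD : δ.eval t = D)
    (hD₁ : t * (derivative δ).eval t = D₁)
    (hD₂ : t * (derivative δ).eval t + t ^ 2 * (derivative (derivative δ)).eval t = D₂)
    (hUp : Up = (4 : ℝ[X]) * a ^ 4 * m * δ * (X * derivative (X * derivative δ)) - (3 : ℝ[X]) * a ^ 4 * m * (X * derivative δ) ^ 2 + (4 : ℝ[X]) * a ^ 4 * δ ^ 2 * (X * derivative (X * derivative m)) - (4 : ℝ[X]) * a ^ 4 * δ * (X * derivative m) * (X * derivative δ) - a ^ 3 * m ^ 3 * (X * derivative (X * derivative δ)) - (5 : ℝ[X]) * a ^ 3 * m ^ 2 * δ * (X * derivative (X * derivative m)) + (4 : ℝ[X]) * a ^ 3 * m ^ 2 * (X * derivative m) * (X * derivative δ) - (8 : ℝ[X]) * a ^ 3 * m * δ ^ 2 * (X * derivative (X * derivative a)) + (2 : ℝ[X]) * a ^ 3 * m * δ * (X * derivative a) * (X * derivative δ) + a ^ 3 * m * δ * (X * derivative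 m) ^ 2 - (4 : ℝ[X]) * a ^ 3 * δ ^ 2 * (X * derivative a) * (X * derivative m) + a ^ 2 * m ^ 4 * (X * derivative (X * derivative m)) + (6 : ℝ[X]) * a ^ 2 * m ^ 3 * δ * (X * derivative (X * derivative a)) - (2 : ℝ[X]) * a ^ 2 * m ^ 3 * (X * derivative a) * (X * derivative δ) - a ^ 2 * m ^ 3 * (X * derivative m) ^ 2 + (4 : ℝ[X]) * a ^ 2 * m ^ 2 * δ * (X * derivative a) * (X * derivative m) + (9 : ℝ[X]) * a ^ 2 * m * δ ^ 2 * (X * derivative a) ^ 2 - a * m ^ 5 * (X * derivative (X * derivative a)) - (7 : ℝ[X]) * a * m ^ 3 * δ * (X * derivative a) ^ 2 + m ^ 5 * (X * derivative a) ^ 2)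
    (hVp : Vp = (4 : ℝ[X]) * a ^ 4 * δ ^ 2 * (X * derivative (X * derivative δ)) - (4 : ℝ[X]) * a ^ 4 * δ * (X * derivative δ) ^ 2 - a ^ 3 * m ^ 2 * δ * (X * derivative (X * derivative δ)) - (4 : ℝ[X]) * a ^ 3 * m * δ ^ 2 * (X * derivative (X * derivative m)) + (4 : ℝ[X]) * a ^ 3 * m * δ * (X * derivative m) * (X * derivative δ) - (4 : ℝ[X]) * a ^ 3 * δ ^ 3 * (X * derivative (X * derivative a)) + a ^ 2 * m ^ 3 * δ * (X * derivative (X * derivative m)) + (5 : ℝ[X]) * a ^ 2 * m ^ 2 * δ ^ 2 * (X * derivative (X * derivative a)) - (2 : ℝ[X]) * a ^ 2 * m ^ 2 * δ * (X * derivative a) * (X * derivative δ) - a ^ 2 * m ^ 2 * δ * (X * derivative m) ^ 2 + (4 : ℝ[X]) * a ^ 2 * m * δ ^ 2 * (X * derivative a) * (X * derivative m) + (4 : ℝ[X]) * a ^ 2 * δ ^ 3 * (X * derivative a) ^ 2 - a * m ^ 4 * δ * (X * derivative (X * derivative a)) - (6 : ℝ[X]) * a * m ^ 2 * δ ^ 2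 * (X * derivative a) ^ 2 + m ^ 4 * δ * (X * derivative a) ^ 2)
    (hΨ0 : A * b ^ 2 + M * b + D = 0)
    (hH : (4 : ℝ) * b ^ 6 * A ^ 2 * A₂ - (4 : ℝ) * b ^ 6 * A * A₁ ^ 2 + (4 : ℝ) * b ^ 5 * A ^ 2 * M₂ + (4 : ℝ) * b ^ 5 * A * M * A₂ - (4 : ℝ) * b ^ 5 * A * A₁ * M₁ - (3 : ℝ) * b ^ 5 * M * A₁ ^ 2 + (4 : ℝ) * b ^ 4 * A ^ 2 * D₂ + (4 : ℝ) * b ^ 4 * A * M * M₂ + b ^ 4 * M ^ 2 * A₂ - (4 : ℝ) * b ^ 4 * M * A₁ * M₁ + (4 : ℝ) * b ^ 3 * A * M * D₂ + (4 : ℝ) * b ^ 3 * A * M₁ * D₁ + b ^ 3 * M ^ 2 * M₂ - (2 : ℝ) * b ^ 3 * M * A₁ * D₁ - b ^ 3 * M * M₁ ^ 2 + (4 : ℝ) * b ^ 2 * A * D₁ ^ 2 + b ^ 2 * M ^ 2 * D₂ + b * M * D₁ ^ 2 = 0) :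
    Up.eval t * b + Vp.eval t = 0 := by
  have h := hess_reduce_poly a m δ Up Vp t b A M D A₁ M₁ D₁ A₂ M₂ D₂ hA hA₁ hA₂ hM hM₁ hM₂ hD hD₁ hD₂ hUp hVp hΨ0
  rw [hH, mul_zero] at h
  exact h.symm

-- same statement size as `hess_reduce_poly`.
set_option maxHeartbeats 1600000 in
/-- **One polynomial for the abscissae**: at an osculation point, `A·V(t)² − M·U(t)·V(t) + D·U(t)² = 0`; so every
osculation abscissa `t` with `U(t) ≠ 0` is a root of `N = a V² − m U V + δ U²` (and see `osc_ordinate_eq`).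
[folklore] -/
theorem osc_abscissa_root (a m δ Up Vp : ℝ[X]) (t b : ℝ) (A M D A₁ M₁ D₁ A₂ M₂ D₂ : ℝ)
    (hA : a.eval t = A)
    (hA₁ : t * (derivative a).eval t = A₁)
    (hA₂ : t * (derivative a).eval t + t ^ 2 * (derivative (derivative a)).eval t = A₂)
    (hM : m.eval t = M)
    (hM₁ : t * (derivative m).eval t = M₁)
    (hM₂ : t * (derivative m).eval t + t ^ 2 * (derivative (derivative m)).eval t = M₂)
    (hD : δ.eval t = D)
    (hD₁ : t * (derivative δ).eval t = D₁)
    (hD₂ : t * (derivative δ).eval t + t ^ 2 * (derivative (derivative δ)).eval t = D₂)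
    (hUp : Up = (4 : ℝ[X]) * a ^ 4 * m * δ * (X * derivative (X * derivative δ)) - (3 : ℝ[X]) * a ^ 4 * m * (X * derivative δ) ^ 2 + (4 : ℝ[X]) * a ^ 4 * δ ^ 2 * (X * derivative (X * derivative m)) - (4 : ℝ[X]) * a ^ 4 * δ * (X * derivative m) * (X * derivative δ) - a ^ 3 * m ^ 3 * (X * derivative (X * derivative δ)) - (5 : ℝ[X]) * a ^ 3 * m ^ 2 * δ * (X * derivative (X * derivative m)) + (4 : ℝ[X]) * a ^ 3 * m ^ 2 * (X * derivative m) * (X * derivative δ) - (8 : ℝ[X]) * a ^ 3 * m * δ ^ 2 * (X * derivative (X * derivative a)) + (2 : ℝ[X]) * a ^ 3 * m * δ * (X * derivative a) * (X * derivative δ) + a ^ 3 * m * δ * (X * derivative m) ^ 2 - (4 : ℝ[X]) * a ^ 3 * δ ^ 2 * (X * derivative a) * (X * derivative m) + a ^ 2 * m ^ 4 * (X * derivative (X * derivative m)) + (6 : ℝ[X]) * a ^ 2 * m ^ 3 * δ * (X * derivative (X * derivative a)) - (2 : ℝ[X]) * a ^ 2 * m ^ 3 * (X * derivative a) * (X *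 derivative δ) - a ^ 2 * m ^ 3 * (X * derivative m) ^ 2 + (4 : ℝ[X]) * a ^ 2 * m ^ 2 * δ * (X * derivative a) * (X * derivative m) + (9 : ℝ[X]) * a ^ 2 * m * δ ^ 2 * (X * derivative a) ^ 2 - a * m ^ 5 * (X * derivative (X * derivative a)) - (7 : ℝ[X]) * a * m ^ 3 * δ * (X * derivative a) ^ 2 + m ^ 5 * (X * derivative a) ^ 2)
    (hVp : Vp = (4 : ℝ[X]) * a ^ 4 * δ ^ 2 * (X * derivative (X * derivative δ)) - (4 : ℝ[X]) * a ^ 4 * δ * (X * derivative δ) ^ 2 - a ^ 3 * m ^ 2 * δ * (X * derivative (X * derivative δ)) - (4 : ℝ[X]) * a ^ 3 * m * δ ^ 2 * (X * derivative (X * derivative m)) + (4 : ℝ[X]) * a ^ 3 * m * δ * (X * derivative m) * (X * derivative δ) - (4 : ℝ[X]) * a ^ 3 * δ ^ 3 * (X * derivative (X * derivative a)) + a ^ 2 * m ^ 3 * δ * (X * derivative (X * derivative m)) + (5 : ℝ[X]) * a ^ 2 * m ^ 2 * δ ^ 2 * (X * derivative (X * derivative a)) - (2 : ℝ[X]) *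 a ^ 2 * m ^ 2 * δ * (X * derivative a) * (X * derivative δ) - a ^ 2 * m ^ 2 * δ * (X * derivative m) ^ 2 + (4 : ℝ[X]) * a ^ 2 * m * δ ^ 2 * (X * derivative a) * (X * derivative m) + (4 : ℝ[X]) * a ^ 2 * δ ^ 3 * (X * derivative a) ^ 2 - a * m ^ 4 * δ * (X * derivative (X * derivative a)) - (6 : ℝ[X]) * a * m ^ 2 * δ ^ 2 * (X * derivative a) ^ 2 + m ^ 4 * δ * (X * derivative a) ^ 2)
    (hΨ0 : A * b ^ 2 + M * b + D = 0)
    (hH : (4 : ℝ) * b ^ 6 * A ^ 2 * A₂ - (4 : ℝ) * b ^ 6 * A * A₁ ^ 2 + (4 : ℝ) * b ^ 5 * A ^ 2 * M₂ + (4 : ℝ) * b ^ 5 * A * M * A₂ - (4 : ℝ) * b ^ 5 * A * A₁ * M₁ - (3 : ℝ) * b ^ 5 * M * A₁ ^ 2 + (4 : ℝ) * b ^ 4 * A ^ 2 * D₂ + (4 : ℝ) * b ^ 4 * A * M * M₂ + b ^ 4 * M ^ 2 * A₂ - (4 : ℝ) * b ^ 4 * M * A₁ * M₁ + (4 : ℝ)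 * b ^ 3 * A * M * D₂ + (4 : ℝ) * b ^ 3 * A * M₁ * D₁ + b ^ 3 * M ^ 2 * M₂ - (2 : ℝ) * b ^ 3 * M * A₁ * D₁ - b ^ 3 * M * M₁ ^ 2 + (4 : ℝ) * b ^ 2 * A * D₁ ^ 2 + b ^ 2 * M ^ 2 * D₂ + b * M * D₁ ^ 2 = 0) :
    A * (Vp.eval t) ^ 2 - M * Up.eval t * Vp.eval t + D * (Up.eval t) ^ 2 = 0 :=
  resultant_step _ _ _ _ _ b hΨ0 (osc_abscissa a m δ Up Vp t b A M D A₁ M₁ D₁ A₂ M₂ D₂ hA hA₁ hA₂ hM hM₁ hM₂ hD hD₁ hD₂ hUp hVp hΨ0 hH)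

/-- The ordinate is determined: `u ≠ 0`, `u b + v = 0 ⇒ b = −v/u` (each such abscissa carries ONE osculation point).
[folklore] -/
theorem osc_ordinate_eq (u v b : ℝ) (hu : u ≠ 0) (hl : u * b + v = 0) : b = -v / u := by
  field_simp
  linarith

end OsculationCuspGen

end Summit.ValiantsHypothesis.ValiantsHypothesis.Theorems.LacunarySymmetroidMatrixDescartes
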